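import Literature.Computability.Complexity.Mod2TseitinGadget
import Literature.Computability.Complexity.RegularWalks
import Literature.Computability.MetaComplexity.ScopeExpansion
import HarnessLib

/-!
# Tseitin graphs from rotation graphs: degree and boundary expansion from a spectral bound

Grigoriev 2001, §3, takes the Tseitin tautologies on an explicit expander family (Lubotzky–
Phillips–Sarnak / Margulis, "one could take `r = 6`") and uses (Lemma 7(ii)) "applying to `S` the
property of the expanders, we conclude that there are at least `ε₀ k` edges of `G` with one
endpoint in `S` and another endpoint not in `S`". The tree's explicit expanders are ROTATION
GRAPHS (`Expander.RotGraph n d`, Arora–Barak §21.3.1; the family `Expander.Family.XN` of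
`ExpanderFamily.lean`) with a SPECTRAL bound. This file converts:

* `LGraph.ofRot X hn hd` — the loop-free multigraph by edge labels (`Mod2TseitinGadget.LGraph`)
  underlying a rotation graph `X : RotGraph n d`: labels = the smaller of the two dart codes
  `v·d + i` of an edge, self-loops dropped (they are irrelevant mod 2); `ends` decodes a label;
* `LGraph.card_star_ofRot_le` — every vertex has at most `d` labels;
* `LGraph.isBoundaryExpander_ofRot` — if `λ(X) ≤ λ` then for every vertex set `F` with
  `|F| ≤ n/2` at least `d (1 - λ)/2 · |F|` labels have exactly one endpoint in `F`
  (`IsBoundaryExpander`, the hypothesis of the Grigoriev–Schoenebeck pseudo-moments via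
  `vecExpands_of_isBoundaryExpander`), from the counting form of Arora–Barak (22.1)
  (`Expander.sum_sum_le_of_spectralBound`): darts from `F` to `F` are at most `d |F| (1+λ)/2`,
  and distinct boundary darts carry distinct labels.

## References

* D. Grigoriev, *Linear lower bound on degrees of Positivstellensatz calculus proofs for the
  parity*, Theoret. Comput. Sci. 259 (2001) 613–622, §3, Lemma 7(ii). [Grigoriev2001TCS]
* S. Arora, B. Barak, *Computational Complexity: A Modern Approach*, CUP 2009, §21.3.1,
  §22.2.3 eq. (22.1). [AroraBarakCC2009]
-/

noncomputable section

open Finset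
open Literature.Computability.MetaComplexity (IsBoundaryExpander boundary cover coverDegree
  mem_boundary mem_cover)

namespace Literature.Computability.Complexity

namespace LGraph

open Expander Expander.RotGraph

variable {n d : ℕ} (X : Expander.RotGraph n d)

/-! ### Dart codes and edge labels -/

/-- The code `v·d + i` of the dart `(v, i)`. [cite: AroraBarakCC2009, §21.3.1 (darts (v,i))] -/
def dcode (e : Fin n × Fin d) : ℕ := e.1.val * d + e.2.val

/-- Decoding the vertex. [cite: AroraBarakCC2009, §21.3.1] -/
theorem dcode_div (e : Fin n × Fin d) (hd : 0 < d) : dcode e / d = e.1.val := by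
  rw [dcode, Nat.add_comm, Nat.add_mul_div_right _ _ hd, Nat.div_eq_of_lt e.2.isLt, Nat.zero_add]

/-- Decoding the label. [cite: AroraBarakCC2009, §21.3.1] -/
theorem dcode_mod (e : Fin n × Fin d) : dcode e % d = e.2.val := by
  rw [dcode, Nat.add_comm, Nat.add_mul_mod_self_right, Nat.mod_eq_of_lt e.2.isLt]

/-- Dart codes are injective. [cite: AroraBarakCC2009, §21.3.1] -/
theorem dcode_injective : Function.Injective (dcode (n := n) (d := d)) := by
  intro e e' h
  have hd : 0 < d := Fin.pos e.2
  have h1 : e.1.val = e'.1.val := by rw [← dcode_div e hd, ← dcode_div e' hd, h]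
  have h2 : e.2.val = e'.2.val := by rw [← dcode_mod e, ← dcode_mod e', h]
  exact Prod.ext (Fin.ext h1) (Fin.ext h2)

/-- The LABEL of the edge of a dart: the smaller of the codes of the dart and its reverse.
[cite: Grigoriev2001TCS, §3 (the variables X_e of the Tseitin system, one per edge)] -/
def lab (e : Fin n × Fin d) : ℕ := min (dcode e) (dcode (X.rot e))

/-- The reverse dart has the same label. [cite: Grigoriev2001TCS, §3] -/
theorem lab_rot (e : Fin n × Fin d) : lab X (X.rot e) = lab X e := by
  rw [lab, lab, X.rot_rot, min_comm]

/-- The label is the code of the dart or of its reverse. [cite: Grigoriev2001TCS, §3] -/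
theorem lab_eq_or (e : Fin n × Fin d) : lab X e = dcode e ∨ lab X e = dcode (X.rot e) :=
  min_choice _ _

/-- Darts with the same label are equal or reverse to each other. [cite: Grigoriev2001TCS, §3] -/
theorem eq_or_eq_rot_of_lab_eq {e e' : Fin n × Fin d} (h : lab X e = lab X e') :
    e' = e ∨ e' = X.rot e := by
  rcases lab_eq_or X e with h1 | h1 <;> rcases lab_eq_or X e' with h2 | h2 <;> rw [h1, h2] at h
  · exact Or.inl (dcode_injective h).symm
  · right
    have := dcode_injective h
    rw [this, X.rot_rot]
  · exact Or.inr (dcode_injective h).symm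
  · left
    have := dcode_injective h
    have h' := congrArg X.rot this
    rwa [X.rot_rot, X.rot_rot, eq_comm] at h'

/-! ### The multigraph of a rotation graph -/

/-- The non-loop darts. [cite: Grigoriev2001TCS, §3] -/
def nlDarts : Finset (Fin n × Fin d) := univ.filter fun e => X.nbr e.1 e.2 ≠ e.1

/-- Decoding a label into (tail, head) of the dart it codes (junk outside the range).
[cite: AroraBarakCC2009, §21.3.1] -/
def endsOf (hn : 0 < n) (hd : 0 < d) (c : ℕ) : Fin n × Fin n :=
  if h : c / d < n then (⟨c / d, h⟩, X.nbr ⟨c / d, h⟩ ⟨c % d, Nat.mod_lt _ hd⟩) else (⟨0, hn⟩, ⟨0, hn⟩)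

/-- Decoding the code of a dart gives its tail and head. [cite: AroraBarakCC2009, §21.3.1] -/
theorem endsOf_dcode (hn : 0 < n) (hd : 0 < d) (e : Fin n × Fin d) :
    endsOf X hn hd (dcode e) = (e.1, X.nbr e.1 e.2) := by
  have h1 : dcode e / d = e.1.val := dcode_div e hd
  have h2 : dcode e % d = e.2.val := dcode_mod e
  have hlt : dcode e / d < n := by rw [h1]; exact e.1.isLt
  rw [endsOf, dif_pos hlt]
  have hv : (⟨dcode e / d, hlt⟩ : Fin n) = e.1 := Fin.ext h1
  have hi : (⟨dcode e % d, Nat.mod_lt _ hd⟩ : Fin d) = e.2 := Fin.ext h2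
  rw [hv, hi]

/-- The endpoints of the label of a dart are its tail and head, in some order.
[cite: Grigoriev2001TCS, §3] -/
theorem endsOf_lab (hn : 0 < n) (hd : 0 < d) (e : Fin n × Fin d) :
    endsOf X hn hd (lab X e) = (e.1, X.nbr e.1 e.2) ∨
      endsOf X hn hd (lab X e) = (X.nbr e.1 e.2, e.1) := by
  rcases lab_eq_or X e with h | h <;> rw [h, endsOf_dcode]
  · exact Or.inl rfl
  · right
    rw [X.rot_apply]
    simp only [nbr_rlab]

/-- **The loop-free multigraph of a rotation graph** (self-loops dropped, parallel edges kept).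
[cite: Grigoriev2001TCS, §3 (the graphs G_k)] -/
def ofRot (hn : 0 < n) (hd : 0 < d) : LGraph (Fin n) where
  E := (nlDarts X).image (lab X)
  ends := endsOf X hn hd
  ne := by
    intro c hc
    obtain ⟨e, he, rfl⟩ := mem_image.1 hc
    have hne : X.nbr e.1 e.2 ≠ e.1 := (mem_filter.1 he).2
    rcases endsOf_lab X hn hd e with h | h <;> rw [h]
    · exact hne.symm
    · exact hne

variable {X}

/-- The label of a non-loop dart is an edge label. [cite: Grigoriev2001TCS, §3] -/
theorem lab_mem_E {hn : 0 < n} {hd : 0 < d} {e : Fin n × Fin d} (he : X.nbr e.1 e.2 ≠ e.1) :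
    lab X e ∈ (ofRot X hn hd).E :=
  mem_image.2 ⟨e, mem_filter.2 ⟨mem_univ _, he⟩, rfl⟩

/-- **Stars**: the label of the non-loop dart `(u, i)` is at `v` iff `v` is its tail or its head.
[cite: Grigoriev2001TCS, §3] -/
theorem lab_mem_star_iff {hn : 0 < n} {hd : 0 < d} {e : Fin n × Fin d} (he : X.nbr e.1 e.2 ≠ e.1)
    {v : Fin n} : lab X e ∈ (ofRot X hn hd).star v ↔ v = e.1 ∨ v = X.nbr e.1 e.2 := by
  rw [mem_star]
  constructor
  · rintro ⟨-, h⟩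
    rcases endsOf_lab X hn hd e with h' | h' <;>
      rw [show (ofRot X hn hd).ends = endsOf X hn hd from rfl, h'] at h
    · rcases h with h | h
      · exact Or.inl h.symm
      · exact Or.inr h.symm
    · rcases h with h | h
      · exact Or.inr h.symm
      · exact Or.inl h.symm
  · intro h
    refine ⟨lab_mem_E he, ?_⟩
    rw [show (ofRot X hn hd).ends = endsOf X hn hd from rfl]
    rcases endsOf_lab X hn hd e with h' | h' <;> rw [h']
    · rcases h with rfl | rfl
      · exact Or.inl rfl
      · exact Or.inr rfl
    · rcases h with rfl | rfl
      · exact Or.inr rfl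
      · exact Or.inl rfl

/-- Every label at `v` is the label of a dart leaving `v`. [cite: Grigoriev2001TCS, §3] -/
theorem star_subset_image {hn : 0 < n} {hd : 0 < d} (v : Fin n) :
    (ofRot X hn hd).star v ⊆ univ.image fun i : Fin d => lab X (v, i) := by
  intro c hc
  obtain ⟨hE, -⟩ := mem_star.1 hc
  obtain ⟨e, he, rfl⟩ := mem_image.1 hE
  have hne : X.nbr e.1 e.2 ≠ e.1 := (mem_filter.1 he).2
  rcases (lab_mem_star_iff hne).1 hc with rfl | rfl
  · exact mem_image.2 ⟨e.2, mem_univ _, rfl⟩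
  · refine mem_image.2 ⟨X.rlab e.1 e.2, mem_univ _, ?_⟩
    rw [← lab_rot X e, X.rot_apply]

/-- **Degrees**: every vertex carries at most `d` labels. [cite: Grigoriev2001TCS, §3 ("r denotes the valency")] -/
theorem card_star_ofRot_le {hn : 0 < n} {hd : 0 < d} (v : Fin n) :
    ((ofRot X hn hd).star v).card ≤ d :=
  (card_le_card (star_subset_image v)).trans (card_image_le.trans (by simp))

/-! ### Boundary expansion from the spectral bound -/

/-- The boundary darts of `F`: tail in `F`, head outside. [cite: Grigoriev2001TCS, Lemma 7(ii)] -/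
def bdDarts (X : Expander.RotGraph n d) (F : Finset (Fin n)) : Finset (Fin n × Fin d) :=
  univ.filter fun e => e.1 ∈ F ∧ X.nbr e.1 e.2 ∉ F

/-- Distinct boundary darts have distinct labels (the reverse of a boundary dart is not one).
[cite: Grigoriev2001TCS, Lemma 7(ii)] -/
theorem lab_injOn_bdDarts (F : Finset (Fin n)) : Set.InjOn (lab X) (bdDarts X F : Set (Fin n × Fin d)) := by
  intro e he e' he' h
  rw [mem_coe, bdDarts, mem_filter] at he he'
  rcases eq_or_eq_rot_of_lab_eq X h with rfl | rfl
  · rfl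
  · exfalso
    rw [X.rot_apply] at he'
    exact he.2.2 he'.2.1

/-- Labels of boundary darts are boundary labels of the family of stars: they lie in exactly one
star `star v`, `v ∈ F`. [cite: Grigoriev2001TCS, Lemma 7(ii)] -/
theorem lab_mem_boundary {hn : 0 < n} {hd : 0 < d} {F : Finset (Fin n)} {e : Fin n × Fin d}
    (he : e ∈ bdDarts X F) : lab X e ∈ boundary (fun v => (ofRot X hn hd).star v) F := by
  rw [bdDarts, mem_filter] at he
  obtain ⟨-, h1, h2⟩ := he
  have hne : X.nbr e.1 e.2 ≠ e.1 := fun h => h2 (by rw [h]; exact h1)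
  rw [mem_boundary]
  refine ⟨mem_cover.2 ⟨e.1, h1, (lab_mem_star_iff hne).2 (Or.inl rfl)⟩, ?_⟩
  rw [coverDegree]
  have : (F.filter fun v => lab X e ∈ (ofRot X hn hd).star v) = {e.1} := by
    ext v
    rw [mem_filter, lab_mem_star_iff hne, mem_singleton]
    constructor
    · rintro ⟨hv, rfl | rfl⟩
      · rfl
      · exact absurd hv h2
    · rintro rfl
      exact ⟨h1, Or.inl rfl⟩
  rw [this, card_singleton]

/-- Counting the boundary darts: `|bdDarts F| + Σ_{v,w ∈ F} #paths₁(v,w) = d |F|`.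
[cite: Grigoriev2001TCS, Lemma 7(ii)] -/
theorem card_bdDarts_add (F : Finset (Fin n)) :
    (bdDarts X F).card + ∑ v ∈ F, ∑ w ∈ F, X.pathCount 1 v w = d * F.card := by
  have h1 : (bdDarts X F).card = ∑ v ∈ F, ((univ : Finset (Fin d)).filter fun i => X.nbr v i ∉ F).card := by
    rw [bdDarts, card_filter, ← univ_product_univ, sum_product]
    rw [← sum_filter_add_sum_filter_not univ (fun v => v ∈ F)]
    have hzero : ∑ v ∈ univ.filter (fun v => v ∉ F),
        ∑ i : Fin d, (if v ∈ F ∧ X.nbr v i ∉ F then 1 else 0) = 0 := by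
      refine sum_eq_zero fun v hv => sum_eq_zero fun i _ => ?_
      rw [if_neg fun h => (mem_filter.1 hv).2 h.1]
    rw [hzero, add_zero, filter_mem_eq_inter, univ_inter]
    refine sum_congr rfl fun v hv => ?_
    rw [card_filter]
    refine sum_congr rfl fun i _ => ?_
    simp only [hv, true_and]
  have h2 : ∀ v ∈ F, ∑ w ∈ F, X.pathCount 1 v w =
      ((univ : Finset (Fin d)).filter fun i => X.nbr v i ∈ F).card := by
    intro v _
    simp_rw [X.pathCount_one]
    exact sum_card_fiberwise_eq_card_filter univ F fun i => X.nbr v i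
  rw [h1, sum_congr rfl h2, ← sum_add_distrib]
  have h3 : ∀ v ∈ F, ((univ : Finset (Fin d)).filter fun i => X.nbr v i ∉ F).card +
      ((univ : Finset (Fin d)).filter fun i => X.nbr v i ∈ F).card = d := by
    intro v _
    rw [add_comm, card_filter_add_card_filter_not, card_univ, Fintype.card_fin]
  rw [sum_congr rfl h3, sum_const, smul_eq_mul, mul_comm]

/-- **Boundary expansion from the spectral bound.** If `λ(X) ≤ λ` then every `F` with
`|F| ≤ n/2` has at least `d (1-λ)/2 · |F|` boundary labels (labels with exactly one endpoint in
`F`). [cite: Grigoriev2001TCS, Lemma 7(ii) (the expander property used by the Tseitin bound)] -/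
theorem isBoundaryExpander_ofRot (hn : 0 < n) (hd : 0 < d) {lam : ℝ}
    (hX : SpectralBound X.walkMatrix lam) :
    IsBoundaryExpander (fun v => (ofRot X hn hd).star v) ((n : ℝ) / 2) (d * (1 - lam) / 2) := by
  intro F hF
  have h2F : 2 * F.card ≤ n := by
    have : (2 * F.card : ℝ) ≤ n := by linarith
    exact_mod_cast this
  -- boundary darts inject into boundary labels
  have hle : ((bdDarts X F).card : ℝ) ≤ (boundary (fun v => (ofRot X hn hd).star v) F).card := by
    have h := card_le_card (show (bdDarts X F).image (lab X) ⊆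
        boundary (fun v => (ofRot X hn hd).star v) F from
      fun c hc => by
        obtain ⟨e, he, rfl⟩ := mem_image.1 hc
        exact lab_mem_boundary he)
    rw [card_image_of_injOn (lab_injOn_bdDarts F)] at h
    exact_mod_cast h
  refine le_trans ?_ hle
  -- count the boundary darts with (22.1)
  have hcount := card_bdDarts_add (X := X) F
  have hA := X.isWalkMatrix_walkMatrix hd
  have hmix := sum_sum_le_of_spectralBound hA hX F h2F
  have hpaths : (∑ v ∈ F, ∑ w ∈ F, (X.pathCount 1 v w : ℝ)) =
      d * ∑ v ∈ F, ∑ w ∈ F, X.walkMatrix v w := by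
    rw [mul_sum]
    refine sum_congr rfl fun v _ => ?_
    rw [mul_sum]
    refine sum_congr rfl fun w _ => ?_
    rw [X.walkMatrix_apply, mul_div_cancel₀]
    exact_mod_cast hd.ne'
  have hcountR : ((bdDarts X F).card : ℝ) + ∑ v ∈ F, ∑ w ∈ F, (X.pathCount 1 v w : ℝ) = d * F.card := by
    exact_mod_cast hcount
  rw [hpaths] at hcountR
  have hd0 : (0 : ℝ) ≤ d := Nat.cast_nonneg d
  have hmix' : (d : ℝ) * ∑ v ∈ F, ∑ w ∈ F, X.walkMatrix v w ≤ d * (F.card * (1 / 2 + lam / 2)) :=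
    mul_le_mul_of_nonneg_left hmix hd0
  have : (d : ℝ) * (1 - lam) / 2 * F.card = d * F.card - d * (F.card * (1 / 2 + lam / 2)) := by ring
  rw [this]
  linarith

end LGraph

end Literature.Computability.Complexity
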